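import Summits.CriticalPhenomena.PercolationContinuityZ3.Theorems.PercNearOneGluingNoHeavyLowerTailSahiOneStepRelativeLYM
import Summits.CriticalPhenomena.PercolationContinuityZ3.Theorems.PercNearOneGluingNoHeavyLowerTailSahiOneStepLayerPositive
import HarnessLib

/-!
# One-step scheme: the Ψ-INEQUALITY of the good-pivot step at a vertex of a vertex-cover (2-CNF) partner

Support file (prover prim-ineq-prove-3 gen 37; `--supports stmt-CriticalPhenomena-4575`; memo
`run/shared/lean/prim/prim-ineq-prove-3/PROOF-G37-VERTEX-COVER-PARTNERS.md` §3).  No definitions, no named facts, no sorries.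

`psi_of_sections`: for `U` increasing and `F`-determined, `N ⊆ F`, the pair of sections `B¹ := U ⊇ B⁰ := U ∩ {N ⊆ ω}` (the sections of a
vertex-cover event at a vertex with neighbourhood `N`) satisfies the hypothesis `hΨ` of `osN_threshold_goodPivot_step` at every level `t`:
`ℓ¹(1−b¹)(ℓ⁰b⁰ − β⁰) ≤ ℓ⁰(1−b⁰)(ℓ¹b¹ − β¹)`.  Ingredients: layer sums of balls (`real_inter_ballLt_eq_sum`), "a decreasing event prefers the
smaller ball" (`ball_real_mul_compl_inter_le`, from layer monotonicity), and THEOREM A (`relLYM_real_mul_le`) summed over the levels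
(`sum_mul_sumLt_le`); the three combine linearly (memo §3.1 (a)–(c)).
-/

namespace Summit.CriticalPhenomena.PercolationContinuityZ3.Theorems

namespace SahiOneStep

open Finset
open scoped Classical

variable {ι : Type*} [DecidableEq ι]

/-! ## Ball sums -/
section Balls

variable [Fintype ι]

open MeasureTheory
open Literature.Probability.Percolation (DeterminedBy determinedBy_iff)
open Literature.Probability.LatticeModels (prodBernoulli)

omit [DecidableEq ι] in
/-- `μ(E ∩ {N_F < s}) = Σ_{k ≤ |F|, k < s} μ(E ∩ {N_F = k})`. [folklore] -/
theorem real_inter_ballLt_eq_sum (p : ι → unitInterval) (F : Finset ι) (E : Set (Set ι)) (s : ℕ) :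
    (prodBernoulli p).real (E ∩ {ω : Set ι | (F.filter (· ∈ ω)).card < s}) =
      ∑ k ∈ range (F.card + 1), if k < s then (prodBernoulli p).real (E ∩ {ω : Set ι | (F.filter (· ∈ ω)).card = k}) else 0 := by
  rw [real_eq_sum_layers p F]
  refine Finset.sum_congr rfl fun k _ => ?_
  by_cases hk : k < s
  · rw [if_pos hk]; congr 1; ext ω
    simp only [Set.mem_inter_iff, Set.mem_setOf_eq]
    constructor
    · rintro ⟨⟨hE, -⟩, hc⟩; exact ⟨hE, hc⟩
    · rintro ⟨hE, hc⟩; exact ⟨⟨hE, hc ▸ hk⟩, hc⟩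
  · rw [if_neg hk]
    have : E ∩ {ω : Set ι | (F.filter (· ∈ ω)).card < s} ∩ {ω : Set ι | (F.filter (· ∈ ω)).card = k} = ∅ := by
      ext ω; simp only [Set.mem_inter_iff, Set.mem_setOf_eq, Set.mem_empty_iff_false, iff_false]
      rintro ⟨⟨-, hs⟩, hc⟩; exact hk (hc ▸ hs)
    rw [this, measureReal_empty]

omit [DecidableEq ι] in
/-- `μ{N_F < s} = Σ_{k ≤ |F|, k < s} μ{N_F = k}`. [folklore] -/
theorem real_ballLt_eq_sum (p : ι → unitInterval) (F : Finset ι) (s : ℕ) :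
    (prodBernoulli p).real {ω : Set ι | (F.filter (· ∈ ω)).card < s} =
      ∑ k ∈ range (F.card + 1), if k < s then (prodBernoulli p).real {ω : Set ι | (F.filter (· ∈ ω)).card = k} else 0 := by
  have h := real_inter_ballLt_eq_sum p F Set.univ s
  simp only [Set.univ_inter] at h
  exact h

/-- Initial segments under a likelihood-ratio order: if `v_i d_j ≤ v_j d_i` for `i < j` then
`(Σ d)(Σ_{k<s} v) ≤ (Σ v)(Σ_{k<s} d)`. [folklore] -/
theorem sum_mul_sumLt_le (M s : ℕ) (v d : ℕ → ℝ) (mlr : ∀ i j, i < j → v i * d j ≤ v j * d i) :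
    (∑ k ∈ range M, d k) * (∑ k ∈ range M, if k < s then v k else 0) ≤
      (∑ k ∈ range M, v k) * (∑ k ∈ range M, if k < s then d k else 0) := by
  have split : ∀ x : ℕ → ℝ, (∑ k ∈ range M, x k) = (∑ k ∈ range M, if k < s then x k else 0) + ∑ k ∈ range M, if k < s then 0 else x k := by
    intro x; rw [← Finset.sum_add_distrib]; exact Finset.sum_congr rfl fun k _ => by split_ifs <;> simp
  rw [split d, split v, add_mul, add_mul]
  have comm : (∑ k ∈ range M, if k < s then d k else 0) * (∑ k ∈ range M, if k < s then v k else 0) =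
      (∑ k ∈ range M, if k < s then v k else 0) * (∑ k ∈ range M, if k < s then d k else 0) := mul_comm _ _
  rw [comm]
  refine add_le_add le_rfl ?_
  rw [Finset.sum_mul_sum, Finset.sum_mul_sum]
  refine Finset.sum_le_sum fun j _ => Finset.sum_le_sum fun i _ => ?_
  by_cases hj : j < s
  · simp [hj]
  · by_cases hi : i < s
    · rw [if_neg hj, if_pos hi, if_neg hj, if_pos hi]
      have := mlr i j (by omega)
      linarith
    · simp [hi]

/-- **A decreasing event prefers the smaller ball**: for `U` increasing and `F`-determined, `D = Uᶜ`,
`μ{N_F<t}·μ(D ∩ {N_F<t+1}) ≤ μ{N_F<t+1}·μ(D ∩ {N_F<t})`. [folklore; from layer monotonicity] -/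
theorem ball_real_mul_compl_inter_le (p : ι → unitInterval) (F : Finset ι) {U : Set (Set ι)} (hU : IsUpperSet U)
    (hUF : DeterminedBy U (↑F : Set ι)) (t : ℕ) :
    (prodBernoulli p).real {ω : Set ι | (F.filter (· ∈ ω)).card < t} *
        (prodBernoulli p).real (Uᶜ ∩ {ω : Set ι | (F.filter (· ∈ ω)).card < t + 1}) ≤
      (prodBernoulli p).real {ω : Set ι | (F.filter (· ∈ ω)).card < t + 1} *
        (prodBernoulli p).real (Uᶜ ∩ {ω : Set ι | (F.filter (· ∈ ω)).card < t}) := by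
  set μ := prodBernoulli p with hμ
  have hcompl : ∀ s, μ.real (Uᶜ ∩ {ω : Set ι | (F.filter (· ∈ ω)).card < s}) =
      μ.real {ω : Set ι | (F.filter (· ∈ ω)).card < s} - μ.real (U ∩ {ω : Set ι | (F.filter (· ∈ ω)).card < s}) := by
    intro s
    have h := measureReal_inter_add_sdiff (μ := μ) (s := {ω : Set ι | (F.filter (· ∈ ω)).card < s}) (t := U) MeasurableSet.of_discrete
    rw [Set.inter_comm] at h
    have e : {ω : Set ι | (F.filter (· ∈ ω)).card < s} \ U = Uᶜ ∩ {ω : Set ι | (F.filter (· ∈ ω)).card < s} := by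
      ext ω; simp only [Set.mem_sdiff, Set.mem_inter_iff, Set.mem_compl_iff]; tauto
    rw [e] at h; linarith
  rw [hcompl t, hcompl (t + 1)]
  -- reduce to `μ(L0)·μ(U ∩ L1) ≤ μ(L1)·μ(U ∩ L0)`, then to layer sums
  suffices h : μ.real {ω : Set ι | (F.filter (· ∈ ω)).card < t + 1} * μ.real (U ∩ {ω : Set ι | (F.filter (· ∈ ω)).card < t}) ≤
      μ.real {ω : Set ι | (F.filter (· ∈ ω)).card < t} * μ.real (U ∩ {ω : Set ι | (F.filter (· ∈ ω)).card < t + 1}) by nlinarith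
  set π : ℕ → ℝ := fun k => μ.real {ω : Set ι | (F.filter (· ∈ ω)).card = k} with hπ
  set u : ℕ → ℝ := fun k => μ.real (U ∩ {ω : Set ι | (F.filter (· ∈ ω)).card = k}) with hu
  have eL : ∀ s, μ.real {ω : Set ι | (F.filter (· ∈ ω)).card < s} = ∑ k ∈ range (F.card + 1), if k < s then π k else 0 :=
    fun s => real_ballLt_eq_sum p F s
  have eU : ∀ s, μ.real (U ∩ {ω : Set ι | (F.filter (· ∈ ω)).card < s}) = ∑ k ∈ range (F.card + 1), if k < s then u k else 0 :=
    fun s => real_inter_ballLt_eq_sum p F U s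
  have step : ∀ x : ℕ → ℝ, (∑ k ∈ range (F.card + 1), if k < t + 1 then x k else 0) =
      (∑ k ∈ range (F.card + 1), if k < t then x k else 0) + (if t < F.card + 1 then x t else 0) := by
    intro x
    have hk : ∀ k, (if k < t + 1 then x k else 0) = (if k < t then x k else 0) + (if k = t then x k else 0) := by
      intro k
      by_cases h1 : k < t
      · simp [h1, show k < t + 1 by omega, show k ≠ t by omega]
      · by_cases h2 : k = t
        · subst h2; simp
        · simp [h1, h2, show ¬ k < t + 1 by omega]
    rw [Finset.sum_congr rfl (fun k _ => hk k), Finset.sum_add_distrib, Finset.sum_ite_eq' (range (F.card + 1)) t x]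
    simp only [Finset.mem_range]
  rw [eL, eL, eU, eU, step π, step u]
  set Sπ := ∑ k ∈ range (F.card + 1), if k < t then π k else 0 with hSπ
  set Su := ∑ k ∈ range (F.card + 1), if k < t then u k else 0 with hSu
  -- `(Sπ + [π_t])·Su ≤ Sπ·(Su + [u_t])` ⟸ `π_t·Su ≤ Sπ·u_t`
  have key : (if t < F.card + 1 then π t else 0) * Su ≤ Sπ * (if t < F.card + 1 then u t else 0) := by
    by_cases ht : t < F.card + 1
    · rw [if_pos ht, if_pos ht, hSu, hSπ, Finset.mul_sum, Finset.sum_mul]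
      refine Finset.sum_le_sum fun j hj => ?_
      by_cases hjt : j < t
      · rw [if_pos hjt, if_pos hjt]
        have h := real_inter_layer_mul_le p F hU hUF hjt.le
        linarith [h]
      · simp [hjt]
    · simp [ht]
  nlinarith [key]

end Balls

/-! ## The Ψ-inequality of the good-pivot step for a partner whose lower section is `U ∩ {N ⊆ ω}` -/
section Psi

variable [Fintype ι]

open MeasureTheory
open Literature.Probability.Percolation (DeterminedBy determinedBy_iff)
open Literature.Probability.LatticeModels (prodBernoulli)

omit [DecidableEq ι] [Fintype ι] in
/-- `U ∩ {N ⊆ ω} = U ∖ (U ∩ {some coordinate of N absent})`. [folklore] -/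
theorem inter_supset_eq_sdiff (U : Set (Set ι)) (N : Finset ι) :
    U ∩ {ω : Set ι | (↑N : Set ι) ⊆ ω} = U \ {ω : Set ι | ∃ f ∈ N, f ∉ ω} := by
  ext ω
  simp only [Set.mem_inter_iff, Set.mem_setOf_eq, Set.mem_sdiff, not_exists, not_and, not_not, Set.subset_def, Finset.mem_coe]

/-- **THE Ψ-INEQUALITY** (memo §3.1, (G3)).  `U` increasing and `F`-determined, `N ⊆ F`, `B¹ := U`, `B⁰ := U ∩ {N ⊆ ω}`, `L¹ = {N_F < t}`,
`L⁰ = {N_F < t+1}`.  Then `ℓ¹(1−b¹)(ℓ⁰b⁰ − β⁰) ≤ ℓ⁰(1−b⁰)(ℓ¹b¹ − β¹)` — hypothesis `hΨ` of `osN_threshold_goodPivot_step` for a partner with these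
sections (every non-isolated vertex of a vertex-cover event).  Proof: with `D = Uᶜ`, `V = U ∩ {some f ∈ N absent}` it reads
`ℓ¹μ(D)[μ(D∩L⁰)+μ(V∩L⁰)] ≤ ℓ⁰[μ(D)+μ(V)]μ(D∩L¹)`, which follows from `ball_real_mul_compl_inter_le` and from
`μ(D)μ(V∩L⁰) ≤ μ(V)μ(D∩L⁰)` (THEOREM A summed over the levels, `sum_mul_sumLt_le`). [this work] -/
theorem psi_of_sections (p : ι → unitInterval) (F N : Finset ι) (hNF : N ⊆ F) {U : Set (Set ι)} (hU : IsUpperSet U)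
    (hUF : DeterminedBy U (↑F : Set ι)) (t : ℕ) :
    (prodBernoulli p).real {ω : Set ι | (F.filter (· ∈ ω)).card < t} * (1 - (prodBernoulli p).real U) *
        ((prodBernoulli p).real {ω : Set ι | (F.filter (· ∈ ω)).card < t + 1} * (prodBernoulli p).real (U ∩ {ω : Set ι | (↑N : Set ι) ⊆ ω})
          - (prodBernoulli p).real ((U ∩ {ω : Set ι | (↑N : Set ι) ⊆ ω}) ∩ {ω : Set ι | (F.filter (· ∈ ω)).card < t + 1})) ≤
      (prodBernoulli p).real {ω : Set ι | (F.filter (· ∈ ω)).card < t + 1} * (1 - (prodBernoulli p).real (U ∩ {ω : Set ι | (↑N : Set ι) ⊆ ω})) *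
        ((prodBernoulli p).real {ω : Set ι | (F.filter (· ∈ ω)).card < t} * (prodBernoulli p).real U
          - (prodBernoulli p).real (U ∩ {ω : Set ι | (F.filter (· ∈ ω)).card < t})) := by
  set μ := prodBernoulli p with hμ
  set L1 : Set (Set ι) := {ω : Set ι | (F.filter (· ∈ ω)).card < t} with hL1
  set L0 : Set (Set ι) := {ω : Set ι | (F.filter (· ∈ ω)).card < t + 1} with hL0
  set Ms : Set (Set ι) := {ω : Set ι | ∃ f ∈ N, f ∉ ω} with hMs
  have hB0 : U ∩ {ω : Set ι | (↑N : Set ι) ⊆ ω} = U \ Ms := inter_supset_eq_sdiff U N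
  rw [hB0]
  -- the measures involved
  have mD : μ.real Uᶜ = 1 - μ.real U := probReal_compl_eq_one_sub MeasurableSet.of_discrete
  have mB0 : μ.real (U \ Ms) = μ.real U - μ.real (U ∩ Ms) := by
    have h := measureReal_inter_add_sdiff (μ := μ) (s := U) (t := Ms) MeasurableSet.of_discrete; linarith
  have mB0L : μ.real ((U \ Ms) ∩ L0) = μ.real (U ∩ L0) - μ.real (U ∩ Ms ∩ L0) := by
    have h := measureReal_inter_add_sdiff (μ := μ) (s := U ∩ L0) (t := Ms) MeasurableSet.of_discrete
    have e1 : U ∩ L0 ∩ Ms = U ∩ Ms ∩ L0 := by ext ω; simp only [Set.mem_inter_iff]; tauto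
    have e2 : (U ∩ L0) \ Ms = (U \ Ms) ∩ L0 := by ext ω; simp only [Set.mem_inter_iff, Set.mem_sdiff]; tauto
    rw [e1, e2] at h; linarith
  have mUL : ∀ L : Set (Set ι), μ.real (U ∩ L) = μ.real L - μ.real (Uᶜ ∩ L) := by
    intro L
    have h := measureReal_inter_add_sdiff (μ := μ) (s := L) (t := U) MeasurableSet.of_discrete
    have e1 : L ∩ U = U ∩ L := Set.inter_comm _ _
    have e2 : L \ U = Uᶜ ∩ L := by ext ω; simp only [Set.mem_sdiff, Set.mem_inter_iff, Set.mem_compl_iff]; tauto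
    rw [e1, e2] at h; linarith
  -- (a) the decreasing event `Uᶜ` prefers the smaller ball
  have ha : μ.real L1 * μ.real (Uᶜ ∩ L0) ≤ μ.real L0 * μ.real (Uᶜ ∩ L1) := ball_real_mul_compl_inter_le p F hU hUF t
  -- (c′) `μ(D)·μ(V ∩ L0) ≤ μ(V)·μ(D ∩ L0)` from THEOREM A summed over levels
  have hc : μ.real Uᶜ * μ.real (U ∩ Ms ∩ L0) ≤ μ.real (U ∩ Ms) * μ.real (Uᶜ ∩ L0) := by
    set v : ℕ → ℝ := fun k => μ.real (U ∩ Ms ∩ {ω : Set ι | (F.filter (· ∈ ω)).card = k}) with hv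
    set d : ℕ → ℝ := fun k => μ.real (Uᶜ ∩ {ω : Set ι | (F.filter (· ∈ ω)).card = k}) with hd
    have eD : μ.real Uᶜ = ∑ k ∈ range (F.card + 1), d k := real_eq_sum_layers p F Uᶜ
    have eV : μ.real (U ∩ Ms) = ∑ k ∈ range (F.card + 1), v k := real_eq_sum_layers p F (U ∩ Ms)
    have eVL : μ.real (U ∩ Ms ∩ L0) = ∑ k ∈ range (F.card + 1), if k < t + 1 then v k else 0 := real_inter_ballLt_eq_sum p F (U ∩ Ms) (t + 1)
    have eDL : μ.real (Uᶜ ∩ L0) = ∑ k ∈ range (F.card + 1), if k < t + 1 then d k else 0 := real_inter_ballLt_eq_sum p F Uᶜ (t + 1)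
    rw [eD, eV, eVL, eDL]
    exact sum_mul_sumLt_le _ _ v d fun i j hij => relLYM_real_mul_le p F N hNF hU hUF hij
  -- assemble: in terms of `dd = μ(Uᶜ)`, `v = μ(U ∩ Ms)` the claim is `ℓ¹·dd·(dL0 + vL0) ≤ ℓ⁰·(dd + v)·dL1` up to cancelling terms
  have mU : μ.real U = 1 - μ.real Uᶜ := by linarith [mD]
  rw [mB0, mB0L, mUL L0, mUL L1, mU]
  have h0 : 0 ≤ μ.real Uᶜ := measureReal_nonneg
  have h1 : 0 ≤ μ.real (U ∩ Ms) := measureReal_nonneg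
  have h2 : 0 ≤ μ.real L1 := measureReal_nonneg
  have k1 := mul_le_mul_of_nonneg_left ha h0
  have k2 := mul_le_mul_of_nonneg_left ha h1
  have k3 := mul_le_mul_of_nonneg_left hc h2
  nlinarith [k1, k2, k3]

end Psi

end SahiOneStep

end Summit.CriticalPhenomena.PercolationContinuityZ3.Theorems
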